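import Mathlib.Algebra.BigOperators.Ring.Finset
import Mathlib.Algebra.BigOperators.Intervals
import Mathlib.Algebra.BigOperators.Field
import Mathlib.Algebra.Order.BigOperators.Group.Finset
import Summits.Ventures.CertifiedArithmetic.LowPrec.SRLimitedBitsCounts
import HarnessLib

/-!
# Few-bit stochastic rounding: EXACT input-averaged bias of the P3109 modes A / B / C on every
# finite input grid (venture file LXVIII of the SR slice)

HONEST FRAMING: certified error envelopes and provably optimal rounding/accumulation schemes for
low-precision formats under stated cost models; every table by two implementations; no hardware
or vendor claims.

Venture CertifiedArithmetic / lowprec, SR slice.  Setting of [FitzgibbonFelix2025] §III-E: the value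
to be rounded carries `D` excess bits, i.e. its residual on the gap of the target format is one of
the `2^D` equally likely grid points `x_i = i / 2^D`; the rounding uses `N` uniformly random bits.
File `SRLimitedBitsCounts` gives the EXACT per-input away-probabilities of the three IEEE P3109
stochastic modes, `P_A(x) = ⌊x 2^N⌋/2^N` (= SRFF of [FitzgibbonFelix2025], = `SR_{p,r}` of
[ElararEtAl2025]), `P_B(x) = ⌊x 2^N + ½⌋/2^N` (= SRF), `P_C(x) = RNITE(x 2^N)/2^N` (= SRC with
round-to-nearest-even pre-rounding; the dictionary is file LXIX, `SRFewBitsDictionary`).  Here we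
prove the input-AVERAGED bias `2^{-D} Σ_{i<2^D} (P(x_i) − x_i)` EXACTLY for every `(N, D)`:

| mode | `N ≤ D` (`D` excess bits not resolved) | `D ≤ N` |
|---|---|---|
| A (SRFF) | `−(2^{-N} − 2^{-D})/2` (`gridAvg_probAwayA`) | `0` (`gridAvg_probAwayA_of_le`) |
| B (SRF) | `+2^{-(D+1)}` for `N < D` (`gridAvg_probAwayB`) | `0` (`gridAvg_probAwayB_of_le`) |
| C (SRC/RNE) | `0` for `1 ≤ N` (`gridAvg_probAwayC`); `−2^{-(D+1)}` for `N = 0 < D` (`gridAvg_probAwayC_zero_bits`) | `0` (`gridAvg_probAwayC_of_le`) |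

and the paper's one-sided bounds for all `(N, D)` (`gridAvg_probAwayA_le`, `gridAvg_probAwayB_le`).
[FitzgibbonFelix2025] App. A-C/A-D derive the `N ≤ D` column for A and B (with "≤" and a tightness
remark) and assert the C column in words (§III-F); the `D ≤ N` column, the `N = 0` row of C (zero
random bits = deterministic round-to-nearest-even, average bias `−2^{-(D+1)}` on every grid) and
the exactness are new here as kernel-checked statements.  Method (elementary): write the grid index
as `i = a·2^{D−N} + b`; then `x_i 2^N = a + b/2^{D−N}` and the three integer roundings are `a`,
`a + [2b ≥ 2^{D−N}]`, `a + [2b > 2^{D−N}] + [2b = 2^{D−N}]·[a odd]` (`floor_block`,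
`floor_block_half`, `rnite_block`); sum over the blocks (`gridAvg_blocks`).  Pointwise (per-input)
statements are stronger and live in files `SRLimitedBitsCounts` / `SRLimitedBits`; no claim about
any implementation.
-/

namespace Summit.Ventures.CertifiedArithmetic.LowPrec.SR.LimitedBits

open Literature.ComputerArithmetic.P3109
open Finset

variable {K : Type*} [Field K] [LinearOrder K] [IsStrictOrderedRing K] [FloorRing K]

/-! ### Block decomposition and elementary sums -/

omit [LinearOrder K] [IsStrictOrderedRing K] [FloorRing K] in
/-- `Σ_{i < B·k} f(i) = Σ_{a<B} Σ_{b<k} f(a k + b)`. -/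
theorem sum_range_mul_blocks (f : ℕ → K) (B k : ℕ) :
    ∑ i ∈ range (B * k), f i = ∑ a ∈ range B, ∑ b ∈ range k, f (a * k + b) := by
  induction B with
  | zero => simp
  | succ B ih => rw [Nat.succ_mul, sum_range_add, ih, sum_range_succ]

omit [FloorRing K] in
/-- Gauss: `Σ_{i<n} i = n(n−1)/2` (cast to `K`). -/
theorem sum_range_natCast (n : ℕ) : ∑ i ∈ range n, (i : K) = (n : K) * ((n : K) - 1) / 2 := by
  induction n with
  | zero => simp
  | succ n ih => rw [sum_range_succ, ih]; push_cast; field_simp; ring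

omit [LinearOrder K] [IsStrictOrderedRing K] [FloorRing K] in
/-- `#{b < 2h : 2h ≤ 2b} = h`, as a sum of indicators. -/
theorem sum_ite_half_le (h : ℕ) :
    ∑ b ∈ range (2 * h), (if 2 * h ≤ 2 * b then (1 : K) else 0) = h := by
  rw [Finset.sum_boole]
  have : (range (2 * h)).filter (fun b => 2 * h ≤ 2 * b) = Ico h (2 * h) := by
    ext b; simp only [mem_filter, mem_range, mem_Ico]; omega
  rw [this, Nat.card_Ico, show 2 * h - h = h by omega]

omit [LinearOrder K] [IsStrictOrderedRing K] [FloorRing K] in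
/-- The RNITE extra count on one block of even length `2h ≥ 2`:
`Σ_{b<2h} ([2b > 2h] + t·[2b = 2h]) = (h − 1) + t`. -/
theorem sum_ite_rnite_extra (h : ℕ) (hh : 1 ≤ h) (t : K) :
    ∑ b ∈ range (2 * h), (if 2 * b < 2 * h then (0 : K) else if 2 * h < 2 * b then 1 else t)
      = (h : K) - 1 + t := by
  have hsplit : ∀ b ∈ range (2 * h),
      (if 2 * b < 2 * h then (0 : K) else if 2 * h < 2 * b then 1 else t)
        = (if h < b then (1 : K) else 0) + (if h = b then t else 0) := by
    intro b _
    by_cases h1 : 2 * b < 2 * h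
    · rw [if_pos h1, if_neg (by omega), if_neg (by omega)]; ring
    · rw [if_neg h1]
      by_cases h2 : 2 * h < 2 * b
      · rw [if_pos h2, if_pos (by omega), if_neg (by omega)]; ring
      · rw [if_neg h2, if_neg (by omega), if_pos (by omega)]; ring
  rw [sum_congr rfl hsplit, sum_add_distrib, Finset.sum_boole, sum_ite_eq]
  have : (range (2 * h)).filter (fun b => h < b) = Ico (h + 1) (2 * h) := by
    ext b; simp only [mem_filter, mem_range, mem_Ico]; omega
  rw [this, Nat.card_Ico, if_pos (mem_range.2 (by omega)), Nat.cast_sub (by omega)]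
  push_cast; ring

omit [LinearOrder K] [IsStrictOrderedRing K] [FloorRing K] in
/-- Half of the numbers below `2m` are odd: `Σ_{a<2m} [a odd] = m`. -/
theorem sum_ite_odd (m : ℕ) : ∑ a ∈ range (2 * m), (if Odd a then (1 : K) else 0) = m := by
  induction m with
  | zero => simp
  | succ m ih =>
    rw [show 2 * (m + 1) = 2 * m + 1 + 1 by ring, sum_range_succ, sum_range_succ, ih,
      if_neg (Nat.not_odd_iff_even.2 (even_two_mul m)), if_pos (odd_two_mul_add_one m)]
    push_cast; ring

/-! ### The three integer roundings on a block -/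

/-- `⌊(a k + b)/k⌋ = a` for `b < k`. -/
theorem floor_block (a b k : ℕ) (hb : b < k) : ⌊((a * k + b : ℕ) : K) / k⌋ = a := by
  have hk : (0 : K) < k := by exact_mod_cast (show 0 < k by omega)
  have hbk : (b : K) < k := by exact_mod_cast hb
  rw [Int.floor_eq_iff]
  push_cast
  refine ⟨?_, ?_⟩
  · rw [le_div_iff₀ hk]
    have : (0 : K) ≤ b := by positivity
    linarith
  · rw [div_lt_iff₀ hk]; nlinarith

/-- `⌊(a k + b)/k + ½⌋ = a + [k ≤ 2b]` for `b < k`. -/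
theorem floor_block_half (a b k : ℕ) (hb : b < k) :
    ⌊((a * k + b : ℕ) : K) / k + 1 / 2⌋ = a + if k ≤ 2 * b then 1 else 0 := by
  have hk : (0 : K) < k := by exact_mod_cast (show 0 < k by omega)
  have hbk : (b : K) < k := by exact_mod_cast hb
  have e : ((a * k + b : ℕ) : K) / k = a + b / k := by
    push_cast; field_simp
  rw [e, Int.floor_eq_iff]
  split_ifs with h
  · have h' : (k : K) ≤ 2 * b := by exact_mod_cast h
    have h1 : (1 : K) / 2 ≤ b / k := by rw [div_le_div_iff₀ (by norm_num) hk]; linarith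
    have h2 : (b : K) / k < 1 := by rw [div_lt_one hk]; exact hbk
    push_cast
    constructor <;> linarith
  · have h' : 2 * (b : K) < k := by exact_mod_cast (show 2 * b < k by omega)
    have h1 : (0 : K) ≤ b / k := by positivity
    have h2 : (b : K) / k < 1 / 2 := by rw [div_lt_div_iff₀ hk (by norm_num)]; linarith
    push_cast
    constructor <;> linarith

/-- `RNITE((a k + b)/k) = a + [2b > k] + [2b = k]·[a odd]` for `b < k`. -/
theorem rnite_block (a b k : ℕ) (hb : b < k) :
    rnite (((a * k + b : ℕ) : K) / k)
      = a + if 2 * b < k then 0 else if k < 2 * b then 1 else if Odd a then 1 else 0 := by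
  have hk : (0 : K) < k := by exact_mod_cast (show 0 < k by omega)
  have hfl := floor_block (K := K) a b k hb
  have e : ((a * k + b : ℕ) : K) / k = a + b / k := by
    push_cast; field_simp
  unfold rnite
  rw [hfl, e]
  by_cases h1 : 2 * b < k
  · have h' : 2 * (b : K) < k := by exact_mod_cast h1
    have : (b : K) / k < 1 / 2 := by rw [div_lt_div_iff₀ hk (by norm_num)]; linarith
    rw [if_pos (by push_cast; linarith), if_pos h1]; simp
  · rw [if_neg h1]
    by_cases h2 : k < 2 * b
    · have h' : (k : K) < 2 * b := by exact_mod_cast h2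
      have : (1 : K) / 2 < b / k := by rw [div_lt_div_iff₀ (by norm_num) hk]; linarith
      rw [if_neg (by push_cast; linarith), if_pos (by push_cast; linarith), if_pos h2]
    · have h' : 2 * (b : K) = k := by exact_mod_cast (show 2 * b = k by omega)
      have : (b : K) / k = 1 / 2 := by rw [div_eq_div_iff (ne_of_gt hk) (by norm_num)]; linarith
      rw [if_neg (by push_cast; linarith), if_neg (by push_cast; linarith), if_neg h2]
      simp [Int.odd_coe_nat]

/-! ### Generic block summation of a grid average -/

omit [FloorRing K] in
/-- Scaling a grid residual by `2^N`: `(i / 2^{N+j}) · 2^N = i / 2^j`. -/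
theorem grid_scale (N j i : ℕ) : ((i : K) / 2 ^ (N + j)) * 2 ^ N = (i : K) / ((2 ^ j : ℕ) : K) := by
  push_cast; rw [pow_add]; field_simp

omit [FloorRing K] in
/-- **Block summation.**  If an integer rounding `c` of `x_i 2^N`, on the block `i = a 2^j + b`
(`b < 2^j`, `D = N + j`), equals `a + e(a,b)`, then the grid average of `c/2^N − x` is
`(2^{-D} − 2^{-N})/2 + (Σ_a Σ_b e)/(2^N 2^D)`. -/
theorem gridAvg_blocks (N j : ℕ) (c : K → ℤ) (e : ℕ → ℕ → K)
    (hc : ∀ a b : ℕ, b < 2 ^ j →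
      ((c ((((a * 2 ^ j + b : ℕ) : K) / 2 ^ (N + j)) * 2 ^ N) : ℤ) : K) = a + e a b) :
    (∑ i ∈ range (2 ^ (N + j)), (((c (((i : K) / 2 ^ (N + j)) * 2 ^ N) : ℤ) : K) / 2 ^ N
        - (i : K) / 2 ^ (N + j))) / 2 ^ (N + j)
      = (1 / 2 ^ (N + j) - 1 / 2 ^ N) / 2
        + (∑ a ∈ range (2 ^ N), ∑ b ∈ range (2 ^ j), e a b) / (2 ^ N * 2 ^ (N + j)) := by
  have hx : ∑ i ∈ range (2 ^ (N + j)), ((i : K) / 2 ^ (N + j)) = ((2 : K) ^ (N + j) - 1) / 2 := by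
    rw [← Finset.sum_div, sum_range_natCast]; push_cast; field_simp
  have hcs : ∑ i ∈ range (2 ^ (N + j)), (((c (((i : K) / 2 ^ (N + j)) * 2 ^ N) : ℤ) : K))
      = (2 : K) ^ j * (2 ^ N * (2 ^ N - 1) / 2)
        + ∑ a ∈ range (2 ^ N), ∑ b ∈ range (2 ^ j), e a b := by
    rw [pow_add, sum_range_mul_blocks]
    rw [sum_congr rfl (fun a _ => sum_congr rfl (fun b hb => hc a b (mem_range.1 hb)))]
    simp only [sum_add_distrib, sum_const, card_range, nsmul_eq_mul]
    rw [← Finset.mul_sum, sum_range_natCast]; push_cast; ring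
  rw [sum_sub_distrib, ← Finset.sum_div, hcs, hx]
  field_simp
  ring

omit [FloorRing K] in
/-- **Resolved regime.**  If `D ≤ N` (`N = D + j`) every grid residual times `2^N` is an integer;
an integer rounding `c` fixing integers then has grid average bias `0`. -/
theorem gridAvg_resolved (D j : ℕ) (c : K → ℤ) (hc : ∀ m : ℕ, c (m : K) = m) :
    (∑ i ∈ range (2 ^ D), (((c (((i : K) / 2 ^ D) * 2 ^ (D + j)) : ℤ) : K) / 2 ^ (D + j)
        - (i : K) / 2 ^ D)) / 2 ^ D = 0 := by
  have hz : ∀ i ∈ range (2 ^ D), ((c (((i : K) / 2 ^ D) * 2 ^ (D + j)) : ℤ) : K) / 2 ^ (D + j)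
      - (i : K) / 2 ^ D = 0 := by
    intro i _
    have e : ((i : K) / 2 ^ D) * 2 ^ (D + j) = ((i * 2 ^ j : ℕ) : K) := by
      push_cast; rw [pow_add]; field_simp
    rw [e, hc]; push_cast; rw [pow_add]; field_simp; ring
  rw [sum_congr rfl hz]; simp

/-! ### Mode A (= SRFF = `SR_{p,r}`): exact grid-averaged bias -/

/-- **Mode A, `N ≤ D`**: `2^{-D} Σ_i (P_A(x_i) − x_i) = (2^{-D} − 2^{-N})/2 = −(2^{-N} − 2^{-D})/2`
([FitzgibbonFelix2025] App. A-C, there with "≤" and "tight for `N ≤ D`"; exact here). -/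
theorem gridAvg_probAwayA {N D : ℕ} (hND : N ≤ D) :
    (∑ i ∈ range (2 ^ D), (probAwayA N ((i : K) / 2 ^ D) - (i : K) / 2 ^ D)) / 2 ^ D
      = (1 / 2 ^ D - 1 / 2 ^ N) / 2 := by
  obtain ⟨j, rfl⟩ := Nat.exists_eq_add_of_le hND
  unfold probAwayA
  have h := gridAvg_blocks (K := K) N j (fun y => ⌊y⌋) (fun _ _ => 0) (fun a b hb => by
    rw [grid_scale, floor_block a b _ hb]; simp)
  simpa using h

/-- **Mode A, `D ≤ N`**: the random bits resolve every grid residual, `P_A(x_i) = x_i`, average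
bias `0`. -/
theorem gridAvg_probAwayA_of_le {N D : ℕ} (hDN : D ≤ N) :
    (∑ i ∈ range (2 ^ D), (probAwayA N ((i : K) / 2 ^ D) - (i : K) / 2 ^ D)) / 2 ^ D = 0 := by
  obtain ⟨j, rfl⟩ := Nat.exists_eq_add_of_le hDN
  unfold probAwayA
  exact gridAvg_resolved (K := K) D j (fun y => ⌊y⌋) (fun m => Int.floor_natCast m)

/-- **Mode A, all `(N, D)`**: the one-sided bound `≤ (2^{-D} − 2^{-N})/2` of
[FitzgibbonFelix2025] App. A-C. -/
theorem gridAvg_probAwayA_le (N D : ℕ) :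
    (∑ i ∈ range (2 ^ D), (probAwayA N ((i : K) / 2 ^ D) - (i : K) / 2 ^ D)) / 2 ^ D
      ≤ (1 / 2 ^ D - 1 / 2 ^ N) / 2 := by
  rcases le_total N D with h | h
  · exact (gridAvg_probAwayA h).le
  · rw [gridAvg_probAwayA_of_le h]
    have : (1 : K) / 2 ^ N ≤ 1 / 2 ^ D :=
      one_div_le_one_div_of_le (by positivity) (pow_le_pow_right₀ (by norm_num) h)
    linarith

/-! ### Mode B (= SRF): exact grid-averaged bias -/

/-- **Mode B, `N < D`**: `2^{-D} Σ_i (P_B(x_i) − x_i) = 2^{-(D+1)}` — independent of `N`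
([FitzgibbonFelix2025] App. A-D; exact here).  SRF, unbiased over real inputs, is biased UP on
every finite input grid it does not resolve. -/
theorem gridAvg_probAwayB {N D : ℕ} (hND : N < D) :
    (∑ i ∈ range (2 ^ D), (probAwayB N ((i : K) / 2 ^ D) - (i : K) / 2 ^ D)) / 2 ^ D
      = 1 / 2 ^ (D + 1) := by
  obtain ⟨j, rfl⟩ := Nat.exists_eq_add_of_le hND
  rw [show N + 1 + j = N + (j + 1) by ring]
  unfold probAwayB
  have h := gridAvg_blocks (K := K) N (j + 1) (fun y => ⌊y + 1 / 2⌋)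
    (fun _ b => if 2 ^ (j + 1) ≤ 2 * b then 1 else 0) (fun a b hb => by
      rw [grid_scale, floor_block_half a b _ hb]; push_cast; rfl)
  rw [h]
  have hs : ∑ a ∈ range (2 ^ N), ∑ b ∈ range (2 ^ (j + 1)),
      (if 2 ^ (j + 1) ≤ 2 * b then (1 : K) else 0) = 2 ^ N * 2 ^ j := by
    rw [show (2 : ℕ) ^ (j + 1) = 2 * 2 ^ j by ring, sum_const, card_range, sum_ite_half_le,
      nsmul_eq_mul]
    push_cast; ring
  rw [hs]; field_simp; ring

/-- **Mode B, `D ≤ N`**: resolved residuals, average bias `0`. -/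
theorem gridAvg_probAwayB_of_le {N D : ℕ} (hDN : D ≤ N) :
    (∑ i ∈ range (2 ^ D), (probAwayB N ((i : K) / 2 ^ D) - (i : K) / 2 ^ D)) / 2 ^ D = 0 := by
  obtain ⟨j, rfl⟩ := Nat.exists_eq_add_of_le hDN
  unfold probAwayB
  refine gridAvg_resolved (K := K) D j (fun y => ⌊y + 1 / 2⌋) (fun m => ?_)
  have h12 : ⌊(1 / 2 : K)⌋ = 0 := Int.floor_eq_iff.2 ⟨by norm_num, by norm_num⟩
  show ⌊(m : K) + 1 / 2⌋ = m
  rw [Int.floor_natCast_add, h12, add_zero]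

/-- **Mode B, all `(N, D)`**: the one-sided bound `≤ 2^{-(D+1)}` of [FitzgibbonFelix2025]
App. A-D. -/
theorem gridAvg_probAwayB_le (N D : ℕ) :
    (∑ i ∈ range (2 ^ D), (probAwayB N ((i : K) / 2 ^ D) - (i : K) / 2 ^ D)) / 2 ^ D
      ≤ 1 / 2 ^ (D + 1) := by
  rcases lt_or_ge N D with h | h
  · exact (gridAvg_probAwayB h).le
  · rw [gridAvg_probAwayB_of_le h]; positivity

/-! ### Mode C (= SRC with round-to-nearest-even): exact grid-averaged bias -/

/-- **Mode C, `1 ≤ N < D`**: `2^{-D} Σ_i (P_C(x_i) − x_i) = 0` — the ties-to-even pre-rounding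
makes few-bit SR unbiased ON AVERAGE over every input grid ([FitzgibbonFelix2025] §III-F, asserted
there; proved here).  Pointwise it is biased by up to `2^{-(N+1)}` (`abs_probAwayC_sub_le`). -/
theorem gridAvg_probAwayC {N D : ℕ} (h1 : 1 ≤ N) (hND : N < D) :
    (∑ i ∈ range (2 ^ D), (probAwayC N ((i : K) / 2 ^ D) - (i : K) / 2 ^ D)) / 2 ^ D = 0 := by
  obtain ⟨j, rfl⟩ := Nat.exists_eq_add_of_le hND
  rw [show N + 1 + j = N + (j + 1) by ring]
  unfold probAwayC
  have h := gridAvg_blocks (K := K) N (j + 1) (fun y => rnite y)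
    (fun a b => if 2 * b < 2 ^ (j + 1) then 0 else if 2 ^ (j + 1) < 2 * b then 1
      else if Odd a then 1 else 0) (fun a b hb => by
      rw [grid_scale, rnite_block a b _ hb]; push_cast; rfl)
  rw [h]
  obtain ⟨m, rfl⟩ : ∃ m, N = m + 1 := ⟨N - 1, by omega⟩
  have hs : ∑ a ∈ range (2 ^ (m + 1)), ∑ b ∈ range (2 ^ (j + 1)),
      (if 2 * b < 2 ^ (j + 1) then (0 : K) else if 2 ^ (j + 1) < 2 * b then 1
        else if Odd a then 1 else 0) = 2 ^ (m + 1) * (2 ^ j - 1) + 2 ^ m := by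
    rw [show (2 : ℕ) ^ (j + 1) = 2 * 2 ^ j by ring]
    rw [sum_congr rfl (fun a _ => sum_ite_rnite_extra (2 ^ j) Nat.one_le_two_pow _)]
    rw [sum_add_distrib, sum_const, card_range, nsmul_eq_mul,
      show (2 : ℕ) ^ (m + 1) = 2 * 2 ^ m by ring, sum_ite_odd]
    push_cast; ring
  rw [hs]; field_simp; ring

/-- **Mode C, `D ≤ N`**: resolved residuals, average bias `0`. -/
theorem gridAvg_probAwayC_of_le {N D : ℕ} (hDN : D ≤ N) :
    (∑ i ∈ range (2 ^ D), (probAwayC N ((i : K) / 2 ^ D) - (i : K) / 2 ^ D)) / 2 ^ D = 0 := by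
  obtain ⟨j, rfl⟩ := Nat.exists_eq_add_of_le hDN
  unfold probAwayC
  refine gridAvg_resolved (K := K) D j (fun y => rnite y) (fun m => ?_)
  unfold rnite
  rw [Int.floor_natCast, if_pos (by push_cast; linarith)]

/-- **Mode C with ZERO random bits is round-to-nearest-even**, whose average bias on a grid with
`D ≥ 1` excess bits is `−2^{-(D+1)}` (the single tie `x = ½` goes to the even side `0`): the
hypothesis `1 ≤ N` in `gridAvg_probAwayC` is necessary. -/
theorem gridAvg_probAwayC_zero_bits {D : ℕ} (hD : 1 ≤ D) :
    (∑ i ∈ range (2 ^ D), (probAwayC 0 ((i : K) / 2 ^ D) - (i : K) / 2 ^ D)) / 2 ^ D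
      = -(1 / 2 ^ (D + 1)) := by
  obtain ⟨j, rfl⟩ := Nat.exists_eq_add_of_le hD
  rw [show 1 + j = 0 + (j + 1) by ring]
  unfold probAwayC
  have h := gridAvg_blocks (K := K) 0 (j + 1) (fun y => rnite y)
    (fun a b => if 2 * b < 2 ^ (j + 1) then 0 else if 2 ^ (j + 1) < 2 * b then 1
      else if Odd a then 1 else 0) (fun a b hb => by
      rw [grid_scale, rnite_block a b _ hb]; push_cast; rfl)
  rw [h]
  have hs : ∑ a ∈ range (2 ^ 0), ∑ b ∈ range (2 ^ (j + 1)),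
      (if 2 * b < 2 ^ (j + 1) then (0 : K) else if 2 ^ (j + 1) < 2 * b then 1
        else if Odd a then 1 else 0) = 2 ^ j - 1 := by
    rw [show (2 : ℕ) ^ (j + 1) = 2 * 2 ^ j by ring]
    rw [sum_congr rfl (fun a _ => sum_ite_rnite_extra (2 ^ j) Nat.one_le_two_pow _)]
    simp
  rw [hs]; field_simp; ring

end Summit.Ventures.CertifiedArithmetic.LowPrec.SR.LimitedBits
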